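import Summits.ValiantsHypothesis.ValiantsHypothesis.Theorems.SymPencilPerFourInnerRankHypFamily
import Summits.ValiantsHypothesis.ValiantsHypothesis.Theorems.SymPencilPerFourInnerRankPairs

/-!
# Route `SymPencil` — inner rank of the `2 | 2` row split of `per_4` on a SUBSPACE of the
# `u`-side, II: symmetries and the family alternative for every column pair
# (`--supports` stmt-ValiantsHypothesis-5674 `SdcSuperquadratic`; toward IR9U/IR9H = cell `(9, 7, 8)`
# of the size-`27` table; rung currency only)

Setting as in `SymPencilPerFourInnerRankHypFamily`: `Σ_r c_r t_r(u, y)² = per (u.1; u.2; y₂; y₃)`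
for `u` in a submodule `U ≤ K⁴ × K⁴` (`hJ`), and a linear section `ρ : K⁴ → U` of the second
projection.

* `hJ_perm_U`, `hJ_swap_U`, `hJ_yswap_U` — the hypothesis transported along a simultaneous column
  permutation `π` (to the submodule `U.comap P_π`), along `a ↔ b` (to `U.comap prodComm`), and
  along `y₂ ↔ y₃` (same `U`);
* **`family_pair_U`** — for every column pair `i ≠ j`: given one good point of
  `U ∩ {u.2 ∈ span(e_i, e_j)}`, either `t_r((a,0),(e_i,0)) = t_r((a,0),(e_j,0)) = 0` for all
  `(a, 0) ∈ U` together with `t_r(ρ e_i, (e_i, 0)) = t_r(ρ e_j, (e_j, 0)) = 0`, or the same four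
  identities in the `y₃`-slot (transport of `family₂₃_U` + `columns_of_caseA_U/B_U`);
* `cross_U` — the polarised pairing identity between a point `(a, 0) ∈ U` and a point
  `(0, b) ∈ U`: `2 Σ_r c_r [t_r((a,0),(v,0)) t_r((0,b),(0,w)) + t_r((0,b),(v,0)) t_r((a,0),(0,w))]
  = per (a; b; v; w)`;
* `finrank_le_two_of_two_functionals` — the rank lemma used downstream for `dim ≥ 3` arguments.

Honest framing: lemmas toward IR9U; cell `(9,7,8)` not killed here; `27 ≤ sdc(per_4) ≤ 29`
unchanged; the crux `SdcSuperquadratic` and `VP ≠ VNP` untouched.  No definitions. [folklore]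
-/

noncomputable section

-- single-conjunct layout: Sub = Summit, duplicated namespace component intended
set_option linter.dupNamespace false

namespace Summit.ValiantsHypothesis.ValiantsHypothesis.Theorems.SymPencilPerFourInnerRankHypPairs

open Matrix Finset Module
open Summit.ValiantsHypothesis.ValiantsHypothesis.Theorems.SymPencilPerFourBlocks
open Summit.ValiantsHypothesis.ValiantsHypothesis.Theorems.SymPencilPerFourInnerRankRows
open Summit.ValiantsHypothesis.ValiantsHypothesis.Theorems.SymPencilPerFourInnerRankPairs
open Summit.ValiantsHypothesis.ValiantsHypothesis.Theorems.SymPencilPerFourInnerRankHypFamily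

variable {K : Type*} [Field K] {ι : Type*} [Fintype ι]

/-! ### Symmetries of the hypothesis on a subspace -/

omit [Fintype ι] in
/-- The conjugating pair of column-permutation maps: `P_σ ∘ P_π = id` for `σ = π⁻¹`. [folklore] -/
theorem prodCongr_funCongrLeft_symm_apply (π : Equiv.Perm (Fin 4))
    (x : (Fin 4 → K) × (Fin 4 → K)) :
    ((LinearEquiv.funCongrLeft K K π).prodCongr (LinearEquiv.funCongrLeft K K π)).toLinearMap
      (((LinearEquiv.funCongrLeft K K π.symm).prodCongr
        (LinearEquiv.funCongrLeft K K π.symm)).toLinearMap x) = x := by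
  obtain ⟨a, b⟩ := x
  change ((a ∘ π.symm) ∘ π, (b ∘ π.symm) ∘ π) = (a, b)
  ext i <;> simp

/-- **Column symmetry on a subspace**: transporting `hJ` on `U` along a simultaneous column
permutation `π` gives `hJ` for the transported forms on `U.comap P_π`. [folklore] -/
theorem hJ_perm_U (c : ι → K)
    (t : ι → (((Fin 4 → K) × (Fin 4 → K)) →ₗ[K] ((Fin 4 → K) × (Fin 4 → K)) →ₗ[K] K))
    (U : Submodule K ((Fin 4 → K) × (Fin 4 → K)))
    (hJ : ∀ u ∈ U, ∀ y₂ y₃ : Fin 4 → K,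
      ∑ r, c r * (t r u (y₂, y₃)) ^ 2 = (Matrix.of ![u.1, u.2, y₂, y₃]).permanent)
    (π : Equiv.Perm (Fin 4)) :
    ∀ u ∈ U.comap
        ((LinearEquiv.funCongrLeft K K π).prodCongr (LinearEquiv.funCongrLeft K K π)).toLinearMap,
      ∀ y₂ y₃ : Fin 4 → K,
      ∑ r, c r * ((t r).compl₁₂
        ((LinearEquiv.funCongrLeft K K π).prodCongr (LinearEquiv.funCongrLeft K K π)).toLinearMap
        ((LinearEquiv.funCongrLeft K K π).prodCongr (LinearEquiv.funCongrLeft K K π)).toLinearMap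
          u (y₂, y₃)) ^ 2 = (Matrix.of ![u.1, u.2, y₂, y₃]).permanent := by
  rintro ⟨a, b⟩ hu y₂ y₃
  have h := hJ (a ∘ π, b ∘ π) hu (y₂ ∘ π) (y₃ ∘ π)
  rw [of_rows_comp_perm, Matrix.permanent_permute_rows] at h
  exact h

/-- **Row symmetry `a ↔ b` on a subspace** (to `U.comap prodComm`). [folklore] -/
theorem hJ_swap_U (c : ι → K)
    (t : ι → (((Fin 4 → K) × (Fin 4 → K)) →ₗ[K] ((Fin 4 → K) × (Fin 4 → K)) →ₗ[K] K))
    (U : Submodule K ((Fin 4 → K) × (Fin 4 → K)))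
    (hJ : ∀ u ∈ U, ∀ y₂ y₃ : Fin 4 → K,
      ∑ r, c r * (t r u (y₂, y₃)) ^ 2 = (Matrix.of ![u.1, u.2, y₂, y₃]).permanent) :
    ∀ u ∈ U.comap (LinearEquiv.prodComm K (Fin 4 → K) (Fin 4 → K)).toLinearMap,
      ∀ y₂ y₃ : Fin 4 → K,
      ∑ r, c r * ((t r).compl₁₂ (LinearEquiv.prodComm K (Fin 4 → K) (Fin 4 → K)).toLinearMap
        LinearMap.id u (y₂, y₃)) ^ 2 = (Matrix.of ![u.1, u.2, y₂, y₃]).permanent := by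
  rintro ⟨a, b⟩ hu y₂ y₃
  have h := hJ (b, a) hu y₂ y₃
  rw [per_swap_row₀₁] at h
  exact h

/-- **Row symmetry `y₂ ↔ y₃` on a subspace** (same `U`). [folklore] -/
theorem hJ_yswap_U (c : ι → K)
    (t : ι → (((Fin 4 → K) × (Fin 4 → K)) →ₗ[K] ((Fin 4 → K) × (Fin 4 → K)) →ₗ[K] K))
    (U : Submodule K ((Fin 4 → K) × (Fin 4 → K)))
    (hJ : ∀ u ∈ U, ∀ y₂ y₃ : Fin 4 → K,
      ∑ r, c r * (t r u (y₂, y₃)) ^ 2 = (Matrix.of ![u.1, u.2, y₂, y₃]).permanent) :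
    ∀ u ∈ U, ∀ y₂ y₃ : Fin 4 → K,
      ∑ r, c r * ((t r).compl₂ (LinearEquiv.prodComm K (Fin 4 → K) (Fin 4 → K)).toLinearMap
        u (y₂, y₃)) ^ 2 = (Matrix.of ![u.1, u.2, y₂, y₃]).permanent := by
  intro u hu y₂ y₃
  have h := hJ u hu y₃ y₂
  rw [per_swap_row₂₃] at h
  exact h

/-! ### Symmetry of the `n`-vectors on a pair -/

omit [Fintype ι] in
/-- From the first family alternative on `U`: `t_r(ρ e₃, (e₂, 0)) = t_r(ρ e₂, (e₃, 0))`
(evaluate at `ρ(e₂ + e₃)`). [folklore] -/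
theorem nsym_of_caseA_U
    (t : ι → (((Fin 4 → K) × (Fin 4 → K)) →ₗ[K] ((Fin 4 → K) × (Fin 4 → K)) →ₗ[K] K))
    (U : Submodule K ((Fin 4 → K) × (Fin 4 → K)))
    (ρ : (Fin 4 → K) →ₗ[K] ((Fin 4 → K) × (Fin 4 → K))) (hρ2 : ∀ b, (ρ b).2 = b)
    (hρU : ∀ b, ρ b ∈ U)
    (hA : ∀ u ∈ U, u.2 0 = 0 → u.2 1 = 0 → ∀ r,
        t r u (u.2 2 • Pi.single (2 : Fin 4) (1 : K) - u.2 3 • Pi.single 3 1, 0) = 0) (r : ι) :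
    t r (ρ (Pi.single 3 1)) (Pi.single 2 1, 0) = t r (ρ (Pi.single 2 1)) (Pi.single 3 1, 0) := by
  obtain ⟨-, -, n2, n3⟩ := columns_of_caseA_U t U ρ hρ2 hρU hA
  have h := hA _ (hρU (Pi.single 2 1 + Pi.single 3 1)) (by simp [hρ2]) (by simp [hρ2]) r
  have e : ((((ρ (Pi.single 2 1 + Pi.single 3 1)).2 2) • Pi.single (2 : Fin 4) (1 : K) -
      ((ρ (Pi.single 2 1 + Pi.single 3 1)).2 3) • Pi.single 3 1, (0 : Fin 4 → K)) :
        (Fin 4 → K) × (Fin 4 → K)) = (Pi.single 2 1, 0) - (Pi.single 3 1, 0) := by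
    simp [hρ2]
  rw [e, map_add ρ, map_add (t r), LinearMap.add_apply, map_sub, map_sub, n2 r, n3 r] at h
  linear_combination h

omit [Fintype ι] in
/-- From the second family alternative on `U`: `t_r(ρ e₃, (0, e₂)) = t_r(ρ e₂, (0, e₃))`.
[folklore] -/
theorem msym_of_caseB_U
    (t : ι → (((Fin 4 → K) × (Fin 4 → K)) →ₗ[K] ((Fin 4 → K) × (Fin 4 → K)) →ₗ[K] K))
    (U : Submodule K ((Fin 4 → K) × (Fin 4 → K)))
    (ρ : (Fin 4 → K) →ₗ[K] ((Fin 4 → K) × (Fin 4 → K))) (hρ2 : ∀ b, (ρ b).2 = b)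
    (hρU : ∀ b, ρ b ∈ U)
    (hB : ∀ u ∈ U, u.2 0 = 0 → u.2 1 = 0 → ∀ r,
        t r u (0, u.2 2 • Pi.single (2 : Fin 4) (1 : K) - u.2 3 • Pi.single 3 1) = 0) (r : ι) :
    t r (ρ (Pi.single 3 1)) (0, Pi.single 2 1) = t r (ρ (Pi.single 2 1)) (0, Pi.single 3 1) := by
  obtain ⟨-, -, n2, n3⟩ := columns_of_caseB_U t U ρ hρ2 hρU hB
  have h := hB _ (hρU (Pi.single 2 1 + Pi.single 3 1)) (by simp [hρ2]) (by simp [hρ2]) r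
  have e : (((0 : Fin 4 → K), ((ρ (Pi.single 2 1 + Pi.single 3 1)).2 2) • Pi.single (2 : Fin 4) (1 : K) -
      ((ρ (Pi.single 2 1 + Pi.single 3 1)).2 3) • Pi.single 3 1) :
        (Fin 4 → K) × (Fin 4 → K)) = (0, Pi.single 2 1) - (0, Pi.single 3 1) := by
    simp [hρ2]
  rw [e, map_add ρ, map_add (t r), LinearMap.add_apply, map_sub, map_sub, n2 r, n3 r] at h
  linear_combination h

/-! ### The family alternative for every column pair -/

/-- **Every column pair `i ≠ j` on a subspace.**  Let `hJ` hold on `U` (all weights non-zero,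
`|ι| ≤ 9`), let `ρ` be a linear section of the second projection into `U`, and suppose ONE point
`u ∈ U` with `u.2 ∈ span(e_i, e_j)` has `u.1 m ≠ 0` for the two `m ∉ {i, j}`, `u.2 i ≠ 0`,
`u.2 j ≠ 0` and `u.1 i · u.2 j + u.1 j · u.2 i ≠ 0`.  Then either
`t_r((a,0),(e_i,0)) = t_r((a,0),(e_j,0)) = 0` for all `(a,0) ∈ U` and
`t_r(ρ e_i,(e_i,0)) = t_r(ρ e_j,(e_j,0)) = 0`, `t_r(ρ e_j,(e_i,0)) = t_r(ρ e_i,(e_j,0))`, or the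
same five identities in the `y₃`-slot. [folklore] -/
theorem family_pair_U [CharZero K] [DecidableEq ι] (hι : Fintype.card ι ≤ 9) (c : ι → K)
    (hc : ∀ r, c r ≠ 0)
    (t : ι → (((Fin 4 → K) × (Fin 4 → K)) →ₗ[K] ((Fin 4 → K) × (Fin 4 → K)) →ₗ[K] K))
    (U : Submodule K ((Fin 4 → K) × (Fin 4 → K)))
    (hJ : ∀ u ∈ U, ∀ y₂ y₃ : Fin 4 → K,
      ∑ r, c r * (t r u (y₂, y₃)) ^ 2 = (Matrix.of ![u.1, u.2, y₂, y₃]).permanent)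
    (ρ : (Fin 4 → K) →ₗ[K] ((Fin 4 → K) × (Fin 4 → K))) (hρ2 : ∀ b, (ρ b).2 = b)
    (hρU : ∀ b, ρ b ∈ U) (i j : Fin 4) (hij : i ≠ j)
    (hpt : ∃ u ∈ U, (∀ m, m ≠ i → m ≠ j → u.2 m = 0) ∧ (∀ m, m ≠ i → m ≠ j → u.1 m ≠ 0) ∧
      u.2 i ≠ 0 ∧ u.2 j ≠ 0 ∧ u.1 i * u.2 j + u.1 j * u.2 i ≠ 0) :
    ((∀ a : Fin 4 → K, ((a, (0 : Fin 4 → K)) : (Fin 4 → K) × (Fin 4 → K)) ∈ U →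
        ∀ r, t r (a, 0) (Pi.single i 1, 0) = 0) ∧
      (∀ a : Fin 4 → K, ((a, (0 : Fin 4 → K)) : (Fin 4 → K) × (Fin 4 → K)) ∈ U →
        ∀ r, t r (a, 0) (Pi.single j 1, 0) = 0) ∧
      (∀ r, t r (ρ (Pi.single i 1)) (Pi.single i 1, 0) = 0) ∧
      (∀ r, t r (ρ (Pi.single j 1)) (Pi.single j 1, 0) = 0) ∧
      (∀ r, t r (ρ (Pi.single j 1)) (Pi.single i 1, 0) = t r (ρ (Pi.single i 1)) (Pi.single j 1, 0))) ∨
    ((∀ a : Fin 4 → K, ((a, (0 : Fin 4 → K)) : (Fin 4 → K) × (Fin 4 → K)) ∈ U →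
        ∀ r, t r (a, 0) (0, Pi.single i 1) = 0) ∧
      (∀ a : Fin 4 → K, ((a, (0 : Fin 4 → K)) : (Fin 4 → K) × (Fin 4 → K)) ∈ U →
        ∀ r, t r (a, 0) (0, Pi.single j 1) = 0) ∧
      (∀ r, t r (ρ (Pi.single i 1)) (0, Pi.single i 1) = 0) ∧
      (∀ r, t r (ρ (Pi.single j 1)) (0, Pi.single j 1) = 0) ∧
      (∀ r, t r (ρ (Pi.single j 1)) (0, Pi.single i 1) = t r (ρ (Pi.single i 1)) (0, Pi.single j 1))) := by
  obtain ⟨σ, h2, h3⟩ := exists_perm_two_three i j hij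
  set π := σ.symm with hπ
  have hπ2 : π.symm 2 = i := by rw [hπ, Equiv.symm_symm, h2]
  have hπ3 : π.symm 3 = j := by rw [hπ, Equiv.symm_symm, h3]
  set P := ((LinearEquiv.funCongrLeft K K π).prodCongr (LinearEquiv.funCongrLeft K K π)).toLinearMap
    with hP
  set Pσ := ((LinearEquiv.funCongrLeft K K π.symm).prodCongr
    (LinearEquiv.funCongrLeft K K π.symm)).toLinearMap with hPσ
  have hPP : ∀ x, P (Pσ x) = x := prodCongr_funCongrLeft_symm_apply π
  set t' : ι → (((Fin 4 → K) × (Fin 4 → K)) →ₗ[K] ((Fin 4 → K) × (Fin 4 → K)) →ₗ[K] K) :=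
    fun r => (t r).compl₁₂ P P with ht'
  have hev : ∀ r (a b v w : Fin 4 → K), t' r (a, b) (v, w) = t r (a ∘ π, b ∘ π) (v ∘ π, w ∘ π) :=
    fun r a b v w => rfl
  have hev' : ∀ r (x : (Fin 4 → K) × (Fin 4 → K)) (v w : Fin 4 → K),
      t' r x (v, w) = t r (P x) (v ∘ π, w ∘ π) := fun r x v w => rfl
  set U' := U.comap P with hU'
  have hJ' := hJ_perm_U c t U hJ π
  -- the transported section
  set ρ' : (Fin 4 → K) →ₗ[K] ((Fin 4 → K) × (Fin 4 → K)) :=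
    Pσ ∘ₗ ρ ∘ₗ (LinearEquiv.funCongrLeft K K π).toLinearMap with hρ'
  have hρ'P : ∀ b, P (ρ' b) = ρ (b ∘ π) := fun b => hPP _
  have hρ'2 : ∀ b, (ρ' b).2 = b := fun b => by
    change (ρ (b ∘ π)).2 ∘ π.symm = b
    rw [hρ2]
    funext m; simp
  have hρ'U : ∀ b, ρ' b ∈ U' := fun b => by
    change P (ρ' b) ∈ U
    rw [hρ'P]; exact hρU _
  have e2 : ((Pi.single 2 (1 : K) : Fin 4 → K) ∘ π) = Pi.single i 1 := by
    rw [single_comp_perm, hπ2]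
  have e3 : ((Pi.single 3 (1 : K) : Fin 4 → K) ∘ π) = Pi.single j 1 := by
    rw [single_comp_perm, hπ3]
  have z0 : ((0 : Fin 4 → K) ∘ π) = 0 := rfl
  -- the derivative direction and the good point, transported
  have hσ0i : σ 0 ≠ i := fun h => by
    have := σ.injective (h.trans h2.symm); exact absurd this (by decide)
  have hσ0j : σ 0 ≠ j := fun h => by
    have := σ.injective (h.trans h3.symm); exact absurd this (by decide)
  have hσ1i : σ 1 ≠ i := fun h => by
    have := σ.injective (h.trans h2.symm); exact absurd this (by decide)
  have hσ1j : σ 1 ≠ j := fun h => by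
    have := σ.injective (h.trans h3.symm); exact absurd this (by decide)
  have hmemU' : ∀ x, x ∈ U' ↔ P x ∈ U := fun x => Submodule.mem_comap
  set δ : (Fin 4 → K) × (Fin 4 → K) := Pσ (ρ (Pi.single (σ 0) 1)) with hδ
  have hδU : δ ∈ U' := by rw [hmemU', hδ, hPP]; exact hρU _
  have hδ2 : δ.2 = (Pi.single (σ 0) (1 : K) : Fin 4 → K) ∘ σ := by
    change (ρ (Pi.single (σ 0) 1)).2 ∘ π.symm = _
    rw [hρ2, hπ, Equiv.symm_symm]
  have hδ0 : δ.2 0 = 1 := by rw [hδ2]; simp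
  have hδ1 : δ.2 1 = 0 := by
    rw [hδ2]; simp [σ.injective.eq_iff]
  obtain ⟨u, hu, hz, hnz, hui, huj, hm⟩ := hpt
  have hpt' : ∃ u' ∈ U', u'.2 0 = 0 ∧ u'.2 1 = 0 ∧
      u'.1 0 * u'.1 1 * u'.2 2 * u'.2 3 * (u'.1 2 * u'.2 3 + u'.1 3 * u'.2 2) ≠ 0 := by
    refine ⟨Pσ u, by rw [hmemU', hPP]; exact hu, ?_, ?_, ?_⟩
    · change u.2 (σ.symm.symm 0) = 0
      rw [Equiv.symm_symm]; exact hz _ hσ0i hσ0j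
    · change u.2 (σ.symm.symm 1) = 0
      rw [Equiv.symm_symm]; exact hz _ hσ1i hσ1j
    · change u.1 (σ.symm.symm 0) * u.1 (σ.symm.symm 1) * u.2 (σ.symm.symm 2) *
          u.2 (σ.symm.symm 3) * (u.1 (σ.symm.symm 2) * u.2 (σ.symm.symm 3) +
          u.1 (σ.symm.symm 3) * u.2 (σ.symm.symm 2)) ≠ 0
      rw [Equiv.symm_symm, h2, h3]
      exact mul_ne_zero (mul_ne_zero (mul_ne_zero (mul_ne_zero (hnz _ hσ0i hσ0j)
        (hnz _ hσ1i hσ1j)) hui) huj) hm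
  -- any `a` with `(a, 0) ∈ U` is `a' ∘ π` with `(a', 0) ∈ U'`
  have hsurj : ∀ a : Fin 4 → K, (a ∘ π.symm) ∘ π = a := fun a => by funext q; simp
  have hmem0 : ∀ a : Fin 4 → K, ((a, (0 : Fin 4 → K)) : (Fin 4 → K) × (Fin 4 → K)) ∈ U →
      ((a ∘ π.symm, (0 : Fin 4 → K)) : (Fin 4 → K) × (Fin 4 → K)) ∈ U' := fun a ha => by
    rw [hmemU']
    change ((a ∘ π.symm) ∘ π, (0 : Fin 4 → K) ∘ π) ∈ U
    rw [hsurj]; exact ha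
  rcases family₂₃_U hι c hc t' U' hJ' δ hδU hδ0 hδ1 hpt' with hA | hB
  · left
    obtain ⟨h1, h2', h3', h4⟩ := columns_of_caseA_U t' U' ρ' hρ'2 hρ'U hA
    refine ⟨fun a ha r => ?_, fun a ha r => ?_, fun r => ?_, fun r => ?_, fun r => ?_⟩
    · have := h1 _ (hmem0 a ha) r
      rwa [hev, e2, z0, hsurj] at this
    · have := h2' _ (hmem0 a ha) r
      rwa [hev, e3, z0, hsurj] at this
    · have := h3' r
      rwa [hev', hρ'P, e2, z0] at this
    · have := h4 r
      rwa [hev', hρ'P, e3, z0] at this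
    · have := nsym_of_caseA_U t' U' ρ' hρ'2 hρ'U hA r
      rwa [hev', hev', hρ'P, hρ'P, e2, e3, z0] at this
  · right
    obtain ⟨h1, h2', h3', h4⟩ := columns_of_caseB_U t' U' ρ' hρ'2 hρ'U hB
    refine ⟨fun a ha r => ?_, fun a ha r => ?_, fun r => ?_, fun r => ?_, fun r => ?_⟩
    · have := h1 _ (hmem0 a ha) r
      rwa [hev, e2, z0, hsurj] at this
    · have := h2' _ (hmem0 a ha) r
      rwa [hev, e3, z0, hsurj] at this
    · have := h3' r
      rwa [hev', hρ'P, e2, z0] at this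
    · have := h4 r
      rwa [hev', hρ'P, e3, z0] at this
    · have := msym_of_caseB_U t' U' ρ' hρ'2 hρ'U hB r
      rwa [hev', hev', hρ'P, hρ'P, e2, e3, z0] at this

/-! ### The pairing between a point `(a, 0)` and a point `(0, b)` of `U` -/

/-- **Cross identity.**  For `(a, 0) ∈ U` and `(0, b) ∈ U`:
`2 Σ_r c_r [t_r((a,0),(v,0)) t_r((0,b),(0,w)) + t_r((0,b),(v,0)) t_r((a,0),(0,w))] = per (a;b;v;w)`
(polarise at `(a,b) = (a,0) + (0,b) ∈ U`; the pure terms vanish since `per (a;0;·;·) = per (0;b;·;·)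
= 0`). [folklore] -/
theorem cross_U (c : ι → K)
    (t : ι → (((Fin 4 → K) × (Fin 4 → K)) →ₗ[K] ((Fin 4 → K) × (Fin 4 → K)) →ₗ[K] K))
    (U : Submodule K ((Fin 4 → K) × (Fin 4 → K)))
    (hJ : ∀ u ∈ U, ∀ y₂ y₃ : Fin 4 → K,
      ∑ r, c r * (t r u (y₂, y₃)) ^ 2 = (Matrix.of ![u.1, u.2, y₂, y₃]).permanent)
    (a b : Fin 4 → K) (ha : ((a, (0 : Fin 4 → K)) : (Fin 4 → K) × (Fin 4 → K)) ∈ U)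
    (hb : (((0 : Fin 4 → K), b) : (Fin 4 → K) × (Fin 4 → K)) ∈ U) (v w : Fin 4 → K) :
    2 * ∑ r, c r * (t r (a, 0) (v, 0) * t r (0, b) (0, w) + t r (0, b) (v, 0) * t r (a, 0) (0, w)) =
      (Matrix.of ![a, b, v, w]).permanent := by
  have hab : (((a, b)) : (Fin 4 → K) × (Fin 4 → K)) ∈ U := by
    have := U.add_mem ha hb
    simpa using this
  have h := polar_U c t U hJ (a, b) hab v 0 0 w
  have ha' := polar_U c t U hJ (a, 0) ha v 0 0 w
  have hb' := polar_U c t U hJ (0, b) hb v 0 0 w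
  simp only [per_zero_row₂, add_zero] at h ha' hb'
  rw [show (Matrix.of ![a, (0 : Fin 4 → K), v, w]).permanent = 0 by
    rw [← per_swap_row₀₁]; exact per_zero_row₀ _ _ _] at ha'
  rw [per_zero_row₀] at hb'
  have hsplit : ∀ r (y : (Fin 4 → K) × (Fin 4 → K)), t r (a, b) y = t r (a, 0) y + t r (0, b) y :=
    fun r y => by rw [← LinearMap.add_apply, ← map_add]; simp
  simp_rw [hsplit] at h
  have hexp : ∑ r, c r * (t r (a, 0) (v, 0) + t r (0, b) (v, 0)) *
      (t r (a, 0) (0, w) + t r (0, b) (0, w)) =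
      ∑ r, c r * t r (a, 0) (v, 0) * t r (a, 0) (0, w) +
      ∑ r, c r * (t r (a, 0) (v, 0) * t r (0, b) (0, w) + t r (0, b) (v, 0) * t r (a, 0) (0, w)) +
      ∑ r, c r * t r (0, b) (v, 0) * t r (0, b) (0, w) := by
    rw [← Finset.sum_add_distrib, ← Finset.sum_add_distrib]
    exact Finset.sum_congr rfl fun r _ => by ring
  rw [hexp] at h
  linear_combination h - ha' - hb'


/-! ### A rank lemma: two independent functionals vanishing on `H ≤ K⁴` force `dim H ≤ 2` -/

omit [Fintype ι] in
/-- If two linear functionals `f, g` vanish on `H ≤ K⁴` and there are `x, y` with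
`f x ≠ 0 = g x`, `f y = 0 ≠ g y`, then `finrank H ≤ 2` (`(f, g) : K⁴ → K²` is onto and
`H ≤ ker`). [folklore] -/
theorem finrank_le_two_of_two_functionals (H : Submodule K (Fin 4 → K))
    (f g : (Fin 4 → K) →ₗ[K] K) (hf : ∀ a ∈ H, f a = 0) (hg : ∀ a ∈ H, g a = 0)
    (x y : Fin 4 → K) (hfx : f x ≠ 0) (hgx : g x = 0) (hfy : f y = 0) (hgy : g y ≠ 0) :
    finrank K H ≤ 2 := by
  let L : (Fin 4 → K) →ₗ[K] (K × K) := f.prod g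
  have hsurj : LinearMap.range L = ⊤ := by
    rw [LinearMap.range_eq_top]
    intro p
    refine ⟨(p.1 / f x) • x + (p.2 / g y) • y, ?_⟩
    have e : L ((p.1 / f x) • x + (p.2 / g y) • y) =
        (f ((p.1 / f x) • x + (p.2 / g y) • y), g ((p.1 / f x) • x + (p.2 / g y) • y)) := rfl
    rw [e, map_add, map_add, map_smul, map_smul, map_smul, map_smul, hgx, hfy]
    simp only [smul_eq_mul, mul_zero, add_zero, zero_add, div_mul_cancel₀ _ hfx,
      div_mul_cancel₀ _ hgy]
  have hker : finrank K (LinearMap.ker L) = 2 := by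
    have h := LinearMap.finrank_range_add_finrank_ker L
    rw [hsurj, finrank_top, Module.finrank_prod, Module.finrank_self, finrank_fintype_fun_eq_card,
      Fintype.card_fin] at h
    omega
  have hle : H ≤ LinearMap.ker L := fun a ha => by
    rw [LinearMap.mem_ker, LinearMap.prod_apply, Prod.mk_eq_zero]; exact ⟨hf a ha, hg a ha⟩
  exact hker ▸ Submodule.finrank_mono hle

end Summit.ValiantsHypothesis.ValiantsHypothesis.Theorems.SymPencilPerFourInnerRankHypPairs

end
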